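import Summits.ResolutionOfSingularities.ResolutionOfSingularities.Theorems.FrobeniusLadderFInjectiveMacaulayficationTauFloorBMonicTower
import Summits.ResolutionOfSingularities.ResolutionOfSingularities.Theorems.FrobeniusLadderFInjectiveMacaulayficationTauFloorF5YChartIdent
import Literature.AlgebraicGeometry.Resolution.AffineBlowupAlgebra
import HarnessLib

/-!
# (N2-T″) The chart `D(t̄²)` of `Bl_τ(P2d4B)` is the MONIC HYPERSURFACE `C_T = k[x′, y′, u′, t][z′]/(z′² + t²x′²z′ + t²(y′³+u′³) + t)`: CM at every prime and
# `C_T ≃+* A₀[τ/t̄²] = blowupAlgebra τ (t̄²)`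
# (crux `FInjectiveMacaulayfication` stmt-ResolutionOfSingularities-15315, chain w45a; res-L1-w45a-plan-1 g19 RULING R19.6 (3) «(N2) ROW #3 INPUT LEGALITY → stub-2»,
# legal side, chart `D(t̄²)`; method of `…TauFloorBXChartIdent` (p635410) one level down; seat res-L1-w45a-stub-2 g8)

[OURS · L1 W4.5a] Support file (`--supports stmt-ResolutionOfSingularities-15315 --as helper`); replaces the role of NO printed item; NOT a statement of
any manuscript; def-free (the chart polynomial is a hypothesis `g₀` with its defining equation); UNCONDITIONAL; characteristic-free. AI-written (AI review is
weaker than expert review).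

`A₀ = k[X0..X4]/(f)`, `f = X4² + X0²X4 + X1³ + X2³ + X3⁵` (P2d4B), `τ = Ideal.span {x̄, ȳ, ū, t̄², z̄}`. On `D(t̄²)`: `x = t²x′`, `y = t²y′`, `u = t²u′`, `z = t²z′` and
`f = t⁴·(z′² + t²x′²z′ + t²(y′³+u′³) + t)`, so the chart ring is `C_T = AdjoinRoot g₀`, `g₀ = Z² + (C(X3²X0²)·Z + C(X3²(X1³+X2³) + X3))` over `B₀ = k[X0..X3]`
(`X0 = x′`, `X1 = y′`, `X2 = u′`, `X3 = t`) — MONIC, hence free and finite over `B₀`.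
* §1 `monic_g₀`, `free_finite`, ★ `cmCl_localization` (ONE `exact` over `FlatIntegralCM.cmCl_localization_of_isRegularRing`), `of_X3_sq_mem_nonZeroDivisors`;
* §2 ring identities, `f_rel_away`, ★ `exists_chartMap` (`φ : C_T → A₀[1/t̄²]`, `x′, y′, u′, t, z′ ↦ x̄/t̄², ȳ/t̄², ū/t̄², t̄, z̄/t̄²`; one `AdjoinRoot.lift`),
  ★ `exists_blowdownMap` (`ψ₁ : A₀ → C_T`, `x̄, ȳ, ū, t̄, z̄ ↦ t²x′, t²y′, t²u′, t, t²z′`), ★ `chartMap_injective` (`t²` is a non-zero-divisor of the flat `B₀`-algebra `C_T`);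
* §3 ★★ `exists_chartEquiv : ∃ e : C_T ≃+* blowupAlgebra τ (t̄²)` with the generator values.
[cite: GortzWedhorn2020, (13.19) p. 415] [cite: StacksProject, Tag 0804] [cite: Matsumura1987, Thm. 17.8, Thm. 23.3 (context)]
-/

-- single-problem summit: the doubled namespace component is forced
set_option linter.dupNamespace false

noncomputable section

namespace Summit.ResolutionOfSingularities.ResolutionOfSingularities.Theorems.FInjectiveMacaulayfication.TauFloorBTChart

open MvPolynomial IsLocalization Literature.AlgebraicGeometry.Resolution
open Summit.ResolutionOfSingularities.ResolutionOfSingularities.Theorems.FInjectiveMacaulayfication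
open SliceableCentre

variable (k : Type) [Field k]

/-! ## §1 The monic hypersurface `C_T = k[x′, y′, u′, t][z′]/(g₀)`: free, finite, CM -/

/-- `g₀` is monic. [plumbing] -/
theorem monic_g₀ (g₀ : Polynomial (MvPolynomial (Fin 4) k)) (hg₀ : g₀ = Polynomial.X ^ 2 + (Polynomial.C (X 3 ^ 2 * X 0 ^ 2) * Polynomial.X + Polynomial.C (X 3 ^ 2 * (X 1 ^ 3 + X 2 ^ 3) + X 3))) : g₀.Monic := by
  rw [hg₀]
  nontriviality (MvPolynomial (Fin 4) k)
  refine Polynomial.monic_X_pow_add ?_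
  refine (Polynomial.degree_add_le _ _).trans_lt ?_
  refine max_lt ((Polynomial.degree_C_mul_X_le _).trans_lt (by exact_mod_cast Nat.lt_succ_self 1)) ?_
  exact (Polynomial.degree_C_le).trans_lt (by exact_mod_cast Nat.succ_pos 1)

/-- `C_T` is free and finite over `B₀ = k[x′, y′, u′, t]`. [Mathlib `AdjoinRoot.powerBasis'`] -/
theorem free_finite (g₀ : Polynomial (MvPolynomial (Fin 4) k)) (hg₀ : g₀ = Polynomial.X ^ 2 + (Polynomial.C (X 3 ^ 2 * X 0 ^ 2) * Polynomial.X + Polynomial.C (X 3 ^ 2 * (X 1 ^ 3 + X 2 ^ 3) + X 3))) :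
    Module.Free (MvPolynomial (Fin 4) k) (AdjoinRoot g₀) ∧ Module.Finite (MvPolynomial (Fin 4) k) (AdjoinRoot g₀) :=
  ⟨Module.Free.of_basis (AdjoinRoot.powerBasis' (monic_g₀ k g₀ hg₀)).basis, (AdjoinRoot.powerBasis' (monic_g₀ k g₀ hg₀)).finite⟩

/-- ★ **CM at every prime of `C_T`** (free ⇒ flat, finite ⇒ integral over the regular ring `B₀`). [cite: Matsumura1987, Thm. 17.8, Thm. 23.3 (context)] -/
theorem cmCl_localization (g₀ : Polynomial (MvPolynomial (Fin 4) k)) (hg₀ : g₀ = Polynomial.X ^ 2 + (Polynomial.C (X 3 ^ 2 * X 0 ^ 2) * Polynomial.X + Polynomial.C (X 3 ^ 2 * (X 1 ^ 3 + X 2 ^ 3) + X 3)))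
    (Q : Ideal (AdjoinRoot g₀)) [Q.IsPrime] : CMCl (Localization.AtPrime Q) := by
  obtain ⟨hfree, hfin⟩ := free_finite k g₀ hg₀
  haveI : Algebra.IsIntegral (MvPolynomial (Fin 4) k) (AdjoinRoot g₀) := Algebra.IsIntegral.of_finite _ _
  exact FlatIntegralCM.cmCl_localization_of_isRegularRing (A := MvPolynomial (Fin 4) k) Q

/-- `t² = (of X3)²` is a NON-ZERO-DIVISOR of `C_T` (flatness over the domain `B₀`). [folklore] -/
theorem of_X3_sq_mem_nonZeroDivisors (g₀ : Polynomial (MvPolynomial (Fin 4) k)) (hg₀ : g₀ = Polynomial.X ^ 2 + (Polynomial.C (X 3 ^ 2 * X 0 ^ 2) * Polynomial.X + Polynomial.C (X 3 ^ 2 * (X 1 ^ 3 + X 2 ^ 3) + X 3))) :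
    AdjoinRoot.of g₀ (X 3) ^ 2 ∈ nonZeroDivisors (AdjoinRoot g₀) := by
  obtain ⟨hfree, -⟩ := free_finite k g₀ hg₀
  rw [← map_pow, ← AdjoinRoot.algebraMap_eq]
  exact FlatIntegralCM.mem_nonZeroDivisors_algebraMap_of_flat_of_ne_zero (pow_ne_zero 2 (X_ne_zero 3))

/-- `z′² + t²x′²·z′ + (t²(y′³+u′³) + t) = 0` in `C_T`. [plumbing] -/
theorem root_rel (g₀ : Polynomial (MvPolynomial (Fin 4) k)) (hg₀ : g₀ = Polynomial.X ^ 2 + (Polynomial.C (X 3 ^ 2 * X 0 ^ 2) * Polynomial.X + Polynomial.C (X 3 ^ 2 * (X 1 ^ 3 + X 2 ^ 3) + X 3))) :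
    AdjoinRoot.root g₀ ^ 2 + AdjoinRoot.of g₀ (X 3) ^ 2 * AdjoinRoot.of g₀ (X 0) ^ 2 * AdjoinRoot.root g₀ +
      (AdjoinRoot.of g₀ (X 3) ^ 2 * (AdjoinRoot.of g₀ (X 1) ^ 3 + AdjoinRoot.of g₀ (X 2) ^ 3) + AdjoinRoot.of g₀ (X 3)) = 0 := by
  have h := TauFloorBMonicTower.root_rel_of_eq g₀ _ _ hg₀
  simp only [map_add, map_mul, map_pow] at h
  linear_combination h

/-! ## §2 The chart map, the blow-down map, injectivity -/

/-- `g₀(z·i) = 0` in `A₀[1/t̄²]`: when `z² + x²z + y³ + u³ + T⁵ = 0` and `T²·i = 1`. [ring identity] -/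
theorem ident_z_t {L : Type} [CommRing L] (x y u T z i : L) (hF : z ^ 2 + x ^ 2 * z + y ^ 3 + u ^ 3 + T ^ 5 = 0) (hTi : T ^ 2 * i = 1) :
    (z * i) ^ 2 + (T ^ 2 * (x * i) ^ 2 * (z * i) + (T ^ 2 * ((y * i) ^ 3 + (u * i) ^ 3) + T)) = 0 := by
  linear_combination (i ^ 2) * hF + (x ^ 2 * z * i ^ 2 + y ^ 3 * i ^ 2 + u ^ 3 * i ^ 2 - T * (T ^ 2 * i + 1)) * hTi

/-- `f(t²x′, t²y′, t²u′, t, t²z′) = t⁴·g₀(z′)`. [ring identity] -/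
theorem ident_blowdown_t {T : Type} [CommRing T] (x y u t z : T)
    (hz : z ^ 2 + t ^ 2 * x ^ 2 * z + (t ^ 2 * (y ^ 3 + u ^ 3) + t) = 0) :
    (t ^ 2 * z) ^ 2 + (t ^ 2 * x) ^ 2 * (t ^ 2 * z) + (t ^ 2 * y) ^ 3 + (t ^ 2 * u) ^ 3 + t ^ 5 = 0 := by
  linear_combination (t ^ 4) * hz

/-- `f̄ = 0` read in `A₀[1/t̄²]`, expanded. [plumbing] -/
theorem f_rel_away (f : MvPolynomial (Fin 5) k) (hf : f = X 4 ^ 2 + X 0 ^ 2 * X 4 + X 1 ^ 3 + X 2 ^ 3 + X 3 ^ 5) :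
    algebraMap (MvPolynomial (Fin 5) k ⧸ Ideal.span {f}) (Localization.Away (Ideal.Quotient.mk (Ideal.span {f}) (X 3) ^ 2 : MvPolynomial (Fin 5) k ⧸ Ideal.span {f})) (Ideal.Quotient.mk (Ideal.span {f}) (X 4)) ^ 2 +
      algebraMap (MvPolynomial (Fin 5) k ⧸ Ideal.span {f}) (Localization.Away (Ideal.Quotient.mk (Ideal.span {f}) (X 3) ^ 2 : MvPolynomial (Fin 5) k ⧸ Ideal.span {f})) (Ideal.Quotient.mk (Ideal.span {f}) (X 0)) ^ 2 *
        algebraMap (MvPolynomial (Fin 5) k ⧸ Ideal.span {f}) (Localization.Away (Ideal.Quotient.mk (Ideal.span {f}) (X 3) ^ 2 : MvPolynomial (Fin 5) k ⧸ Ideal.span {f})) (Ideal.Quotient.mk (Ideal.span {f}) (X 4)) +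
      algebraMap (MvPolynomial (Fin 5) k ⧸ Ideal.span {f}) (Localization.Away (Ideal.Quotient.mk (Ideal.span {f}) (X 3) ^ 2 : MvPolynomial (Fin 5) k ⧸ Ideal.span {f})) (Ideal.Quotient.mk (Ideal.span {f}) (X 1)) ^ 3 +
      algebraMap (MvPolynomial (Fin 5) k ⧸ Ideal.span {f}) (Localization.Away (Ideal.Quotient.mk (Ideal.span {f}) (X 3) ^ 2 : MvPolynomial (Fin 5) k ⧸ Ideal.span {f})) (Ideal.Quotient.mk (Ideal.span {f}) (X 2)) ^ 3 +
      algebraMap (MvPolynomial (Fin 5) k ⧸ Ideal.span {f}) (Localization.Away (Ideal.Quotient.mk (Ideal.span {f}) (X 3) ^ 2 : MvPolynomial (Fin 5) k ⧸ Ideal.span {f})) (Ideal.Quotient.mk (Ideal.span {f}) (X 3)) ^ 5 = 0 := by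
  have h0 : Ideal.Quotient.mk (Ideal.span {f}) (X 4 ^ 2 + X 0 ^ 2 * X 4 + X 1 ^ 3 + X 2 ^ 3 + X 3 ^ 5 : MvPolynomial (Fin 5) k) = 0 := by
    rw [← hf]; exact Ideal.Quotient.eq_zero_iff_mem.mpr (Ideal.mem_span_singleton_self f)
  have h1 := congrArg (algebraMap (MvPolynomial (Fin 5) k ⧸ Ideal.span {f}) (Localization.Away (Ideal.Quotient.mk (Ideal.span {f}) (X 3) ^ 2 : MvPolynomial (Fin 5) k ⧸ Ideal.span {f}))) h0
  rw [map_zero] at h1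
  simpa only [map_add, map_mul, map_pow] using h1

/-- ★ **THE CHART MAP `φ : C_T → A₀[1/t̄²]`** (`x′, y′, u′ ↦ x̄/t̄², ȳ/t̄², ū/t̄²`, `t ↦ t̄`, `z′ ↦ z̄/t̄²`): one `AdjoinRoot.lift`. [cite: GortzWedhorn2020, (13.19) p. 415] -/
theorem exists_chartMap (f : MvPolynomial (Fin 5) k) (hf : f = X 4 ^ 2 + X 0 ^ 2 * X 4 + X 1 ^ 3 + X 2 ^ 3 + X 3 ^ 5)
    (g₀ : Polynomial (MvPolynomial (Fin 4) k)) (hg₀ : g₀ = Polynomial.X ^ 2 + (Polynomial.C (X 3 ^ 2 * X 0 ^ 2) * Polynomial.X + Polynomial.C (X 3 ^ 2 * (X 1 ^ 3 + X 2 ^ 3) + X 3))) :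
    ∃ φ : AdjoinRoot g₀ →+* Localization.Away (Ideal.Quotient.mk (Ideal.span {f}) (X 3) ^ 2 : MvPolynomial (Fin 5) k ⧸ Ideal.span {f}),
      (∀ a : k, φ (AdjoinRoot.of g₀ (C a)) = algebraMap (MvPolynomial (Fin 5) k ⧸ Ideal.span {f}) _ (Ideal.Quotient.mk (Ideal.span {f}) (C a))) ∧
      (∀ i : Fin 4, φ (AdjoinRoot.of g₀ (X i)) =
        ![algebraMap (MvPolynomial (Fin 5) k ⧸ Ideal.span {f}) _ (Ideal.Quotient.mk (Ideal.span {f}) (X 0)) * Away.invSelf (Ideal.Quotient.mk (Ideal.span {f}) (X 3) ^ 2), algebraMap (MvPolynomial (Fin 5) k ⧸ Ideal.span {f}) _ (Ideal.Quotient.mk (Ideal.span {f}) (X 1)) * Away.invSelf (Ideal.Quotient.mk (Ideal.span {f}) (X 3) ^ 2), algebraMap (MvPolynomial (Fin 5) k ⧸ Ideal.span {f}) _ (Ideal.Quotient.mk (Ideal.span {f}) (X 2)) * Away.invSelf (Ideal.Quotient.mk (Ideal.span {f}) (X 3) ^ 2),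
          algebraMap (MvPolynomial (Fin 5) k ⧸ Ideal.span {f}) _ (Ideal.Quotient.mk (Ideal.span {f}) (X 3))] i) ∧
      φ (AdjoinRoot.root g₀) = algebraMap (MvPolynomial (Fin 5) k ⧸ Ideal.span {f}) _ (Ideal.Quotient.mk (Ideal.span {f}) (X 4)) * Away.invSelf (Ideal.Quotient.mk (Ideal.span {f}) (X 3) ^ 2) := by
  classical
  let mkA : MvPolynomial (Fin 5) k →+* MvPolynomial (Fin 5) k ⧸ Ideal.span {f} := Ideal.Quotient.mk (Ideal.span {f})
  let L := Localization.Away (mkA (X 3) ^ 2)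
  let ι : (MvPolynomial (Fin 5) k ⧸ Ideal.span {f}) →+* L := algebraMap _ _
  let inv : L := Away.invSelf (mkA (X 3) ^ 2)
  have hTi : ι (mkA (X 3)) ^ 2 * inv = 1 := by
    have h := Away.mul_invSelf (S := L) (mkA (X 3) ^ 2)
    rwa [map_pow] at h
  let v : Fin 4 → L := ![ι (mkA (X 0)) * inv, ι (mkA (X 1)) * inv, ι (mkA (X 2)) * inv, ι (mkA (X 3))]
  let g : MvPolynomial (Fin 4) k →+* L := eval₂Hom (ι.comp (mkA.comp MvPolynomial.C)) v
  have hgX : ∀ i, g (X i) = v i := fun i => eval₂Hom_X' _ _ i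
  have hF := f_rel_away k f hf
  have e1 : Polynomial.eval₂ g (ι (mkA (X 4)) * inv) g₀ = 0 := by
    rw [hg₀]
    simp only [Polynomial.eval₂_add, Polynomial.eval₂_mul, Polynomial.eval₂_pow, Polynomial.eval₂_C, Polynomial.eval₂_X,
      map_add, map_mul, map_pow, hgX]
    exact ident_z_t _ _ _ _ _ _ hF hTi
  refine ⟨AdjoinRoot.lift g _ e1, fun a => ?_, fun i => ?_, AdjoinRoot.lift_root e1⟩
  · rw [AdjoinRoot.lift_of e1]; exact eval₂Hom_C _ _ a
  · rw [AdjoinRoot.lift_of e1, hgX]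

/-- ★ **THE BLOW-DOWN MAP `ψ₁ : A₀ → C_T`** (`x̄, ȳ, ū, t̄, z̄ ↦ t²x′, t²y′, t²u′, t, t²z′`): it kills `f` by `ident_blowdown_t`. [folklore] -/
theorem exists_blowdownMap (f : MvPolynomial (Fin 5) k) (hf : f = X 4 ^ 2 + X 0 ^ 2 * X 4 + X 1 ^ 3 + X 2 ^ 3 + X 3 ^ 5)
    (g₀ : Polynomial (MvPolynomial (Fin 4) k)) (hg₀ : g₀ = Polynomial.X ^ 2 + (Polynomial.C (X 3 ^ 2 * X 0 ^ 2) * Polynomial.X + Polynomial.C (X 3 ^ 2 * (X 1 ^ 3 + X 2 ^ 3) + X 3))) :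
    ∃ ψ₁ : (MvPolynomial (Fin 5) k ⧸ Ideal.span {f}) →+* AdjoinRoot g₀,
      (∀ j : Fin 5, ψ₁ (Ideal.Quotient.mk (Ideal.span {f}) (X j)) =
        ![AdjoinRoot.of g₀ (X 3) ^ 2 * AdjoinRoot.of g₀ (X 0), AdjoinRoot.of g₀ (X 3) ^ 2 * AdjoinRoot.of g₀ (X 1), AdjoinRoot.of g₀ (X 3) ^ 2 * AdjoinRoot.of g₀ (X 2), AdjoinRoot.of g₀ (X 3),
          AdjoinRoot.of g₀ (X 3) ^ 2 * AdjoinRoot.root g₀] j) ∧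
      ∀ a : k, ψ₁ (Ideal.Quotient.mk (Ideal.span {f}) (C a)) = AdjoinRoot.of g₀ (C a) := by
  let u : Fin 5 → AdjoinRoot g₀ := ![AdjoinRoot.of g₀ (X 3) ^ 2 * AdjoinRoot.of g₀ (X 0), AdjoinRoot.of g₀ (X 3) ^ 2 * AdjoinRoot.of g₀ (X 1), AdjoinRoot.of g₀ (X 3) ^ 2 * AdjoinRoot.of g₀ (X 2), AdjoinRoot.of g₀ (X 3),
          AdjoinRoot.of g₀ (X 3) ^ 2 * AdjoinRoot.root g₀]
  have hf0 : eval₂Hom ((AdjoinRoot.of g₀).comp MvPolynomial.C) u f = 0 := by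
    rw [hf]
    simp only [map_add, map_mul, map_pow, eval₂Hom_X']
    exact ident_blowdown_t _ _ _ _ _ (root_rel k g₀ hg₀)
  refine ⟨Ideal.Quotient.lift (Ideal.span {f}) (eval₂Hom ((AdjoinRoot.of g₀).comp MvPolynomial.C) u) ?_, fun j => ?_, fun a => ?_⟩
  · intro a ha
    obtain ⟨c, rfl⟩ := Ideal.mem_span_singleton.mp ha
    rw [map_mul, hf0, zero_mul]
  · rw [Ideal.Quotient.lift_mk]
    exact eval₂Hom_X' _ _ j
  · rw [Ideal.Quotient.lift_mk]
    exact eval₂Hom_C _ _ a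

set_option maxHeartbeats 800000 in
-- one `IsLocalization` lift + a generator-by-generator comparison of two ring maps out of `C_T`
/-- ★ **The chart map is injective**: the blow-down map extended to `A₀[1/t̄²] → C_T[1/t²]` inverts it after `C_T → C_T[1/t²]`, injective since `t²` is a
non-zero-divisor of `C_T`. [folklore] -/
theorem chartMap_injective (f : MvPolynomial (Fin 5) k) (hf : f = X 4 ^ 2 + X 0 ^ 2 * X 4 + X 1 ^ 3 + X 2 ^ 3 + X 3 ^ 5)
    (g₀ : Polynomial (MvPolynomial (Fin 4) k)) (hg₀ : g₀ = Polynomial.X ^ 2 + (Polynomial.C (X 3 ^ 2 * X 0 ^ 2) * Polynomial.X + Polynomial.C (X 3 ^ 2 * (X 1 ^ 3 + X 2 ^ 3) + X 3)))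
    (φ : AdjoinRoot g₀ →+* Localization.Away (Ideal.Quotient.mk (Ideal.span {f}) (X 3) ^ 2 : MvPolynomial (Fin 5) k ⧸ Ideal.span {f}))
    (hφC : ∀ a : k, φ (AdjoinRoot.of g₀ (C a)) = algebraMap (MvPolynomial (Fin 5) k ⧸ Ideal.span {f}) _ (Ideal.Quotient.mk (Ideal.span {f}) (C a)))
    (hφX : ∀ i : Fin 4, φ (AdjoinRoot.of g₀ (X i)) =
        ![algebraMap (MvPolynomial (Fin 5) k ⧸ Ideal.span {f}) _ (Ideal.Quotient.mk (Ideal.span {f}) (X 0)) * Away.invSelf (Ideal.Quotient.mk (Ideal.span {f}) (X 3) ^ 2), algebraMap (MvPolynomial (Fin 5) k ⧸ Ideal.span {f}) _ (Ideal.Quotient.mk (Ideal.span {f}) (X 1)) * Away.invSelf (Ideal.Quotient.mk (Ideal.span {f}) (X 3) ^ 2), algebraMap (MvPolynomial (Fin 5) k ⧸ Ideal.span {f}) _ (Ideal.Quotient.mk (Ideal.span {f}) (X 2)) * Away.invSelf (Ideal.Quotient.mk (Ideal.span {f}) (X 3) ^ 2),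
          algebraMap (MvPolynomial (Fin 5) k ⧸ Ideal.span {f}) _ (Ideal.Quotient.mk (Ideal.span {f}) (X 3))] i)
    (hφz : φ (AdjoinRoot.root g₀) = algebraMap (MvPolynomial (Fin 5) k ⧸ Ideal.span {f}) _ (Ideal.Quotient.mk (Ideal.span {f}) (X 4)) * Away.invSelf (Ideal.Quotient.mk (Ideal.span {f}) (X 3) ^ 2)) :
    Function.Injective φ := by
  classical
  let mkA : MvPolynomial (Fin 5) k →+* MvPolynomial (Fin 5) k ⧸ Ideal.span {f} := Ideal.Quotient.mk (Ideal.span {f})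
  let L := Localization.Away (mkA (X 3) ^ 2)
  let ι : (MvPolynomial (Fin 5) k ⧸ Ideal.span {f}) →+* L := algebraMap _ _
  let inv : L := Away.invSelf (mkA (X 3) ^ 2)
  let tT : AdjoinRoot g₀ := AdjoinRoot.of g₀ (X 3)
  have ht2 : tT ^ 2 ∈ nonZeroDivisors (AdjoinRoot g₀) := of_X3_sq_mem_nonZeroDivisors k g₀ hg₀
  let LT := Localization.Away (tT ^ 2)
  let ιT : AdjoinRoot g₀ →+* LT := algebraMap _ _
  have hιT_inj : Function.Injective ιT :=
    IsLocalization.injective LT (M := Submonoid.powers (tT ^ 2)) ((Submonoid.powers_le (P := nonZeroDivisors _)).mpr ht2)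
  obtain ⟨ψ₁, hψX, hψC⟩ := exists_blowdownMap k f hf g₀ hg₀
  have hψt : ψ₁ (mkA (X 3)) = tT := hψX 3
  have hψt2 : ψ₁ (mkA (X 3) ^ 2) = tT ^ 2 := by rw [map_pow, hψt]
  have hunit : IsUnit ((ιT.comp ψ₁) (mkA (X 3) ^ 2)) := by
    rw [RingHom.comp_apply, hψt2]
    exact IsLocalization.Away.algebraMap_isUnit (tT ^ 2)
  let ψ : L →+* LT := IsLocalization.Away.lift (mkA (X 3) ^ 2) hunit
  have hψι : ∀ a, ψ (ι a) = ιT (ψ₁ a) := fun a => IsLocalization.Away.lift_eq (mkA (X 3) ^ 2) hunit a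
  have hψi : ψ inv * ιT (tT ^ 2) = 1 := by
    have h1 : ψ inv * ψ (ι (mkA (X 3) ^ 2)) = 1 := by
      rw [← map_mul, mul_comm, Away.mul_invSelf, map_one]
    rwa [hψι, hψt2] at h1
  have hcan : ∀ c : AdjoinRoot g₀, ιT (tT ^ 2 * c) * ψ inv = ιT c := fun c => by
    rw [map_mul, mul_comm (ιT (tT ^ 2)), mul_assoc, mul_comm (ιT (tT ^ 2)), hψi, mul_one]
  have hcomp : ψ.comp φ = ιT := by
    refine TauFloorF5YChartAlgebra.adjoinRoot_ringHom_ext (fun r => ?_) ?_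
    · have h0 : ((ψ.comp φ).comp (AdjoinRoot.of g₀)) = ιT.comp (AdjoinRoot.of g₀) := by
        refine MvPolynomial.ringHom_ext (fun a => ?_) (fun i => ?_)
        · change ψ (φ (AdjoinRoot.of g₀ (C a))) = ιT (AdjoinRoot.of g₀ (C a))
          rw [hφC, hψι, hψC]
        · change ψ (φ (AdjoinRoot.of g₀ (X i))) = ιT (AdjoinRoot.of g₀ (X i))
          rw [hφX]
          fin_cases i
          · change ψ (ι (mkA (X 0)) * inv) = ιT (AdjoinRoot.of g₀ (X 0))
            rw [map_mul, hψι, hψX 0]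
            exact hcan _
          · change ψ (ι (mkA (X 1)) * inv) = ιT (AdjoinRoot.of g₀ (X 1))
            rw [map_mul, hψι, hψX 1]
            exact hcan _
          · change ψ (ι (mkA (X 2)) * inv) = ιT (AdjoinRoot.of g₀ (X 2))
            rw [map_mul, hψι, hψX 2]
            exact hcan _
          · change ψ (ι (mkA (X 3))) = ιT (AdjoinRoot.of g₀ (X 3))
            rw [hψι, hψt]
      exact RingHom.congr_fun h0 r
    · rw [RingHom.comp_apply, hφz, map_mul, hψι, hψX 4]
      exact hcan (AdjoinRoot.root g₀)
  have h2 : Function.Injective (⇑ψ ∘ ⇑φ) := by rw [← RingHom.coe_comp, hcomp]; exact hιT_inj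
  exact h2.of_comp

/-! ## §3 ★★ `C_T ≃ A₀[τ/t̄²]` -/

set_option maxHeartbeats 1600000 in
-- generator bookkeeping on both sides (as in `TauFloorBXChartIdent.exists_chartEquiv`)
/-- ★★ **`C_T` is the Rees chart `D(t̄²)` of `Bl_τ X`**: `e : C_T ≃+* blowupAlgebra τ (t̄²)` with `x′, y′, u′, t, z′ ↦ x̄/t̄², ȳ/t̄², ū/t̄², t̄, z̄/t̄²`.
[cite: GortzWedhorn2020, (13.19) p. 415] -/
theorem exists_chartEquiv (f : MvPolynomial (Fin 5) k) (hf : f = X 4 ^ 2 + X 0 ^ 2 * X 4 + X 1 ^ 3 + X 2 ^ 3 + X 3 ^ 5)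
    (g₀ : Polynomial (MvPolynomial (Fin 4) k)) (hg₀ : g₀ = Polynomial.X ^ 2 + (Polynomial.C (X 3 ^ 2 * X 0 ^ 2) * Polynomial.X + Polynomial.C (X 3 ^ 2 * (X 1 ^ 3 + X 2 ^ 3) + X 3))) :
    ∃ e : AdjoinRoot g₀ ≃+* blowupAlgebra (Ideal.span {Ideal.Quotient.mk (Ideal.span {f}) (X 0), Ideal.Quotient.mk (Ideal.span {f}) (X 1), Ideal.Quotient.mk (Ideal.span {f}) (X 2), Ideal.Quotient.mk (Ideal.span {f}) (X 3) ^ 2, Ideal.Quotient.mk (Ideal.span {f}) (X 4)} : Ideal (MvPolynomial (Fin 5) k ⧸ Ideal.span {f})) (Ideal.Quotient.mk (Ideal.span {f}) (X 3) ^ 2),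
      (∀ a : k, ((e (AdjoinRoot.of g₀ (C a)) : blowupAlgebra _ (Ideal.Quotient.mk (Ideal.span {f}) (X 3) ^ 2)) : Localization.Away (Ideal.Quotient.mk (Ideal.span {f}) (X 3) ^ 2 : MvPolynomial (Fin 5) k ⧸ Ideal.span {f})) = algebraMap (MvPolynomial (Fin 5) k ⧸ Ideal.span {f}) _ (Ideal.Quotient.mk (Ideal.span {f}) (C a))) ∧
      (∀ i : Fin 4, ((e (AdjoinRoot.of g₀ (X i)) : blowupAlgebra _ (Ideal.Quotient.mk (Ideal.span {f}) (X 3) ^ 2)) : Localization.Away (Ideal.Quotient.mk (Ideal.span {f}) (X 3) ^ 2 : MvPolynomial (Fin 5) k ⧸ Ideal.span {f})) =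
        ![algebraMap (MvPolynomial (Fin 5) k ⧸ Ideal.span {f}) _ (Ideal.Quotient.mk (Ideal.span {f}) (X 0)) * Away.invSelf (Ideal.Quotient.mk (Ideal.span {f}) (X 3) ^ 2), algebraMap (MvPolynomial (Fin 5) k ⧸ Ideal.span {f}) _ (Ideal.Quotient.mk (Ideal.span {f}) (X 1)) * Away.invSelf (Ideal.Quotient.mk (Ideal.span {f}) (X 3) ^ 2), algebraMap (MvPolynomial (Fin 5) k ⧸ Ideal.span {f}) _ (Ideal.Quotient.mk (Ideal.span {f}) (X 2)) * Away.invSelf (Ideal.Quotient.mk (Ideal.span {f}) (X 3) ^ 2),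
          algebraMap (MvPolynomial (Fin 5) k ⧸ Ideal.span {f}) _ (Ideal.Quotient.mk (Ideal.span {f}) (X 3))] i) ∧
      ((e (AdjoinRoot.root g₀) : blowupAlgebra _ (Ideal.Quotient.mk (Ideal.span {f}) (X 3) ^ 2)) : Localization.Away (Ideal.Quotient.mk (Ideal.span {f}) (X 3) ^ 2 : MvPolynomial (Fin 5) k ⧸ Ideal.span {f})) = algebraMap (MvPolynomial (Fin 5) k ⧸ Ideal.span {f}) _ (Ideal.Quotient.mk (Ideal.span {f}) (X 4)) * Away.invSelf (Ideal.Quotient.mk (Ideal.span {f}) (X 3) ^ 2) := by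
  classical
  obtain ⟨φ, hφC, hφX, hφz⟩ := exists_chartMap k f hf g₀ hg₀
  have hinj := chartMap_injective k f hf g₀ hg₀ φ hφC hφX hφz
  obtain ⟨ψ₁, hψX, hψC⟩ := exists_blowdownMap k f hf g₀ hg₀
  let mkA : MvPolynomial (Fin 5) k →+* MvPolynomial (Fin 5) k ⧸ Ideal.span {f} := Ideal.Quotient.mk (Ideal.span {f})
  let τ : Ideal (MvPolynomial (Fin 5) k ⧸ Ideal.span {f}) := Ideal.span {mkA (X 0), mkA (X 1), mkA (X 2), mkA (X 3) ^ 2, mkA (X 4)}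
  let L := Localization.Away (mkA (X 3) ^ 2)
  let B : Subalgebra (MvPolynomial (Fin 5) k ⧸ Ideal.span {f}) L := blowupAlgebra τ (mkA (X 3) ^ 2)
  let ι : (MvPolynomial (Fin 5) k ⧸ Ideal.span {f}) →+* L := algebraMap _ _
  let inv : L := Away.invSelf (mkA (X 3) ^ 2)
  have hTi : ι (mkA (X 3)) ^ 2 * inv = 1 := by
    have h := Away.mul_invSelf (S := L) (mkA (X 3) ^ 2)
    rwa [map_pow] at h
  -- (1) `φ ∘ ψ₁ = ι`
  have hcan : ∀ j : Fin 5, ι (mkA (X 3)) ^ 2 * (ι (mkA (X j)) * inv) = ι (mkA (X j)) := fun j => by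
    rw [mul_comm, mul_assoc, mul_comm inv, hTi, mul_one]
  have hφψ : φ.comp ψ₁ = ι := by
    refine Ideal.Quotient.ringHom_ext (MvPolynomial.ringHom_ext (fun a => ?_) (fun j => ?_))
    · change φ (ψ₁ (mkA (C a))) = ι (mkA (C a))
      rw [hψC, hφC]
    · change φ (ψ₁ (mkA (X j))) = ι (mkA (X j))
      rw [hψX]
      fin_cases j
      · change φ (AdjoinRoot.of g₀ (X 3) ^ 2 * AdjoinRoot.of g₀ (X 0)) = ι (mkA (X 0))
        rw [map_mul, map_pow, hφX 3, hφX 0]; exact hcan 0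
      · change φ (AdjoinRoot.of g₀ (X 3) ^ 2 * AdjoinRoot.of g₀ (X 1)) = ι (mkA (X 1))
        rw [map_mul, map_pow, hφX 3, hφX 1]; exact hcan 1
      · change φ (AdjoinRoot.of g₀ (X 3) ^ 2 * AdjoinRoot.of g₀ (X 2)) = ι (mkA (X 2))
        rw [map_mul, map_pow, hφX 3, hφX 2]; exact hcan 2
      · exact hφX 3
      · change φ (AdjoinRoot.of g₀ (X 3) ^ 2 * AdjoinRoot.root g₀) = ι (mkA (X 4))
        rw [map_mul, map_pow, hφX 3, hφz]; exact hcan 4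
  have hι_mem : ∀ a, ι a ∈ φ.range := fun a => ⟨ψ₁ a, by rw [← RingHom.comp_apply, hφψ]⟩
  -- (2) `range φ ⊆ B`
  have hB₀ : ∀ b : MvPolynomial (Fin 4) k, φ (AdjoinRoot.of g₀ b) ∈ B := by
    intro b
    induction b using MvPolynomial.induction_on with
    | C a => rw [hφC]; exact B.algebraMap_mem _
    | add p q hp hq => rw [map_add, map_add]; exact B.add_mem hp hq
    | mul_X p i hp =>
      rw [map_mul, map_mul]
      refine B.mul_mem hp ?_
      rw [hφX]
      fin_cases i
      · change ι (mkA (X 0)) * inv ∈ B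
        exact div_mem_blowupAlgebra τ (mkA (X 3) ^ 2) (Ideal.subset_span (by simp))
      · change ι (mkA (X 1)) * inv ∈ B
        exact div_mem_blowupAlgebra τ (mkA (X 3) ^ 2) (Ideal.subset_span (by simp))
      · change ι (mkA (X 2)) * inv ∈ B
        exact div_mem_blowupAlgebra τ (mkA (X 3) ^ 2) (Ideal.subset_span (by simp))
      · exact B.algebraMap_mem (mkA (X 3))
  have hrange_le : ∀ c, φ c ∈ B := by
    refine TauFloorF5YChartIdent.adjoinRoot_subring_eq_top g₀ (B.toSubring.comap φ) (fun b => hB₀ b) ?_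
    change φ (AdjoinRoot.root g₀) ∈ B
    rw [hφz]
    change ι (mkA (X 4)) * inv ∈ B
    exact div_mem_blowupAlgebra τ (mkA (X 3) ^ 2) (Ideal.subset_span (by simp))
  -- (3) `B ⊆ range φ`
  let Rφ : Subalgebra (MvPolynomial (Fin 5) k ⧸ Ideal.span {f}) L :=
    { carrier := φ.range
      mul_mem' := fun ha hb => φ.range.mul_mem ha hb
      one_mem' := φ.range.one_mem
      add_mem' := fun ha hb => φ.range.add_mem ha hb
      zero_mem' := φ.range.zero_mem
      algebraMap_mem' := fun a => hι_mem a }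
  have hgens : blowupAlgebraGens τ (mkA (X 3) ^ 2) ⊆ (Rφ : Set L) := by
    rintro _ ⟨g, hg, rfl⟩
    change ι g * inv ∈ φ.range
    refine Submodule.span_induction (p := fun g _ => ι g * inv ∈ φ.range) ?_ ?_ ?_ ?_ hg
    · intro g hg
      simp only [Set.mem_insert_iff, Set.mem_singleton_iff] at hg
      rcases hg with rfl | rfl | rfl | rfl | rfl
      · exact ⟨AdjoinRoot.of g₀ (X 0), hφX 0⟩
      · exact ⟨AdjoinRoot.of g₀ (X 1), hφX 1⟩
      · exact ⟨AdjoinRoot.of g₀ (X 2), hφX 2⟩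
      · exact ⟨1, by rw [map_one, map_pow ι, hTi]⟩
      · exact ⟨AdjoinRoot.root g₀, hφz⟩
    · rw [map_zero, zero_mul]; exact φ.range.zero_mem
    · intro a b _ _ ha hb
      rw [map_add, add_mul]; exact φ.range.add_mem ha hb
    · intro r a _ ha
      rw [smul_eq_mul, map_mul, mul_assoc]; exact φ.range.mul_mem (hι_mem r) ha
  have hle_range : B ≤ Rφ := Algebra.adjoin_le hgens
  -- (4) the equivalence
  have hsurj : Function.Surjective (φ.codRestrict B.toSubring fun c => hrange_le c) := by
    intro b
    obtain ⟨c, hc⟩ := (hle_range b.2 : (b : L) ∈ φ.range)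
    exact ⟨c, Subtype.ext hc⟩
  have hinj' : Function.Injective (φ.codRestrict B.toSubring fun c => hrange_le c) := fun a b h =>
    hinj (congrArg Subtype.val h)
  exact ⟨RingEquiv.ofBijective (φ.codRestrict B.toSubring fun c => hrange_le c) ⟨hinj', hsurj⟩, hφC, hφX, hφz⟩

end Summit.ResolutionOfSingularities.ResolutionOfSingularities.Theorems.FInjectiveMacaulayfication.TauFloorBTChart

end
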